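import Summits.QuantumFields.YangMills.Theorems.UnitScaleTiltProp7GaugedRowsVacuousAtFlat
import Literature.MathematicalPhysics.QuantumFieldTheory.Balaban1983to89.B8Thm2TorusAt
import Literature.MathematicalPhysics.QuantumFieldTheory.Balaban1983to89.B7Eq170Flat
import HarnessLib

/-!
# Route `UnitScaleTilt`, crux K1 child «MinimiserStabilityRegPr» (stmt-QuantumFields-19200) — DOOR-VACUITY CERTIFICATE, FILE C-I: **THE CENTRE-HEAVY COMPENSATOR —
# a `ℤᵈ` gauge transformation whose level-1 averages (1.29) are ALL `1` while its values at the block corners are prescribed**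

Cell `ym3-torus`, width seat `ym3-torus-px4` (gen 6).  THEOREMS ONLY (0 `def`, 0 `sorry`).  ★★OWNER ym3-torus-plan g29 RULING №16 (5), ★ ym-ust-19200-p1 g17 WORD 21 (b)
GO; LOCATE `ym3-torus-px4/g6/LOCATE-VACUITY-CERT-px4g6.md` §1 [C3] («adjust `u` off the centres», ★p1 LOCATE v3 §0.3).  YM₃ on T³ is a ladder rung (R3), not d = 4, not Clay;
nothing of `hcoW`∕`hcoS`∕E′∕EX∕the crux is claimed; `--supports stmt-QuantumFields-19200`, count-neutral.

THE OBJECT (displayed by hypothesis `hW`, no `def`).  For a block size `L ≥ 2` and a real label `κ(y)` per level-1 block `y ∈ ℤᵈ`, the `SU(2)`-valued (read in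
`M₂(ℂ)ˣ`) gauge transformation `W` of `ℤᵈ` with
  `W(z) = exp(iκ(y)σ₃)` at the CORNER `z = L·y` of the block of `y`,   `W(z) = exp(−iκ(y)σ₃∕(Lᵈ − 1))` at the other `Lᵈ − 1` sites of that block.
Its level-1 average (1.29)∕[Balaban1985Averaging] (78) at the trivial background — prefactor = the corner value, weights `L⁻ᵈ`, principal logarithms — is
`exp(iκσ₃)·exp(L⁻ᵈ·(Lᵈ−1)·(−iκσ₃·(1 + 1∕(Lᵈ−1)))) = exp(iκσ₃)·exp(−iκσ₃) = 1` (§2), for `|κ| ≤ 1∕20` (inside the domain of ✓`B7Eq170Flat.mlog_exp_of_le`).  So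
`Restr129 L 1 (torusLam 1) 1 W` HOLDS (§3) although `W ≠ 1` at every corner with `κ(y) ≠ 0`: the restriction (1.29) constrains AVERAGES, the descent `u ↦ u↓` reads CORNER
VALUES — the gap FILE C-II uses to put the pure-gauge competitor back on the fibre of `V = 1`.

WHAT IS PROVED (ns `…Theorems.Prop7VacuityCompensator`).
* §1 `σ₃`-line algebra in `M₂(ℂ)`: `commute_smul_σ₃`, `exp_smul_σ₃_mul_exp_smul_σ₃` (`e^{aσ₃}e^{bσ₃} = e^{(a+b)σ₃}`, the `ℚ`-algebra structure supplied inside), `σ₃_mul_σ₃`,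
  `norm_σ₃ = 1` (C⋆-identity), `mlog_exp_smul_σ₃` (`‖z‖ ≤ 1∕5`).
* §2 ★★ `rbar_one_compensator` — the level-1 average of `W` at every block is `1`.
* §3 ★★ `restr129_compensator` — `Restr129 L 1 (torusLam 1) 1 W`; `compensator_mem_specialUnitaryUnits` — `W` is `SU(2)`-valued (for the torus descent
  ✓`Prop7AxialReprPrint.exists_su_gauge_of_periodic` in FILE C-II).
* §4 `expHerm` of real multiples of `σ₃`: matrices `e^{±irσ₃}`, products `expHerm(pσ₃)·expHerm(qσ₃)^{±1} = expHerm((p±q)σ₃)` (for FILE C-II's pure gauge).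

HONEST SCOPE.  One explicit exp-mean-log evaluation over the tree's `avgStep`; nothing of Bałaban asserted.

References: T. Bałaban, CMP 99 (1985) 75–102 [Balaban1985RegularSpaces] ((1.29) p.81); CMP 98 (1985) 17–51 [Balaban1985Averaging] ((78)–(81) p.30, (21) p.21).
-/

set_option autoImplicit false
noncomputable section

open scoped BigOperators Matrix.Norms.L2Operator Matrix
open NormedSpace

namespace Summit.QuantumFields.YangMills.Theorems.Prop7VacuityCompensator

open Literature.MathematicalPhysics.QuantumFieldTheory.Balaban1983to89
open B7Prop1Explicit (Site e)
open B7Eq78Linearization (conjR Rbar Rbar_succ Rbar_zero avgStep avgStep_eq_mul_exp_sum zdBlocking)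
open B8Ineq132 (one_conjR)
open B8Eq119TwistedAxial (Restr129 bgT bgT_one)
open B8Thm4TorusAt (torusLam)
open B7Prop2SpecialUnitary (specialUnitaryUnits mem_specialUnitaryUnits)
open B7Eq170Flat (mlog_exp_of_le)
open MatrixLog (mlog mlog_one)
open Literature.MathematicalPhysics.QuantumLattice (blockMap blockBase blockSites mem_blockSites_iff card_blockSites blockMap_blockBase)
open Literature.MathematicalPhysics.QuantumFieldTheory.Balaban1983to89.B9AdOrthogonal (σ₃)
open Summit.QuantumFields.YangMills.Theorems.Prop7GaugedRowsVacuousAtFlat (σ₃_isHermitian_and_trace)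

/-! ## §1 The `σ₃`-line in `M₂(ℂ)` -/

/-- Multiples of `σ₃` commute. [folklore] -/
theorem commute_smul_σ₃ (a b : ℂ) : Commute (a • σ₃) (b • σ₃) :=
  ((Commute.refl σ₃).smul_left a).smul_right b

/-- `e^{aσ₃}·e^{bσ₃} = e^{(a+b)σ₃}`. [folklore] -/
theorem exp_smul_σ₃_mul_exp_smul_σ₃ (a b : ℂ) : exp (a • σ₃) * exp (b • σ₃) = exp ((a + b) • σ₃) := by
  letI : NormedAlgebra ℚ (Matrix (Fin 2) (Fin 2) ℂ) := NormedAlgebra.restrictScalars ℚ ℂ (Matrix (Fin 2) (Fin 2) ℂ)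
  rw [add_smul, exp_add_of_commute (commute_smul_σ₃ a b)]

/-- `σ₃² = 1`. [folklore] -/
theorem σ₃_mul_σ₃ : σ₃ * σ₃ = 1 := by
  ext i j
  fin_cases i <;> fin_cases j <;> simp [σ₃]

/-- `σ₃` is unitary. [folklore] -/
theorem σ₃_mem_unitary : σ₃ ∈ unitary (Matrix (Fin 2) (Fin 2) ℂ) := by
  rw [Unitary.mem_iff, Matrix.star_eq_conjTranspose, σ₃_isHermitian_and_trace.1.eq, σ₃_mul_σ₃]
  exact ⟨rfl, rfl⟩

/-- `‖σ₃‖ = 1` (operator norm; C⋆-identity for a unitary). [folklore] -/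
theorem norm_σ₃ : ‖σ₃‖ = 1 := CStarRing.norm_of_mem_unitary σ₃_mem_unitary

/-- `‖z·σ₃‖ = ‖z‖`. [folklore] -/
theorem norm_smul_σ₃ (z : ℂ) : ‖z • σ₃‖ = ‖z‖ := by rw [norm_smul, norm_σ₃, mul_one]

/-- `log e^{zσ₃} = zσ₃` for `‖z‖ ≤ 1∕5` (principal logarithm of the tree, ✓`B7Eq170Flat.mlog_exp_of_le`). [cite: Balaban1985Averaging, (21) p.21] -/
theorem mlog_exp_smul_σ₃ {z : ℂ} (hz : ‖z‖ ≤ 1 / 5) : mlog (exp (z • σ₃)) = z • σ₃ :=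
  mlog_exp_of_le (by rwa [norm_smul_σ₃])

/-- `e^{−zσ₃}·e^{zσ₃} = 1`. [folklore] -/
theorem exp_neg_smul_σ₃_mul (z : ℂ) : exp ((-z) • σ₃) * exp (z • σ₃) = 1 := by
  rw [exp_smul_σ₃_mul_exp_smul_σ₃, neg_add_cancel, zero_smul, exp_zero]

/-- `e^{zσ₃}·e^{−zσ₃} = 1`. [folklore] -/
theorem exp_smul_σ₃_mul_neg (z : ℂ) : exp (z • σ₃) * exp ((-z) • σ₃) = 1 := by
  rw [exp_smul_σ₃_mul_exp_smul_σ₃, add_neg_cancel, zero_smul, exp_zero]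

/-! ## §2 The level-1 average of the compensator is `1` at every block -/

section Compensator

open Summit.QuantumFields.YangMills.Theorems.Prop7TPrint (expHerm coe_expHerm)
open Summit.QuantumFields.YangMills.Theorems.Prop7GaugedRowsVacuousAtFlat (real_smul_σ₃_isHermitian_and_trace)

variable {d L : ℕ} [NeZero L] (hd : 1 ≤ d) (hL : 2 ≤ L) (κ : Site d → ℝ) {W : Site d → (Matrix (Fin 2) (Fin 2) ℂ)ˣ}
  (hW : ∀ z, ((W z : (Matrix (Fin 2) (Fin 2) ℂ)ˣ) : Matrix (Fin 2) (Fin 2) ℂ) =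
    exp ((Complex.I * (((if blockBase L (blockMap L z) = z then κ (blockMap L z) else -κ (blockMap L z) / ((L : ℝ) ^ d - 1) : ℝ)) : ℂ)) • σ₃))
  (hκ : ∀ y, |κ y| ≤ 1 / 20)
include hW

/-- The CORNER value of the compensator on the block of `y`: `W(L·y) = exp(iκ(y)σ₃)`. [cite: Balaban1985RegularSpaces, (1.29) p.81] -/
theorem coe_compensator_corner (y : Site d) :
    ((W (blockBase L y) : (Matrix (Fin 2) (Fin 2) ℂ)ˣ) : Matrix (Fin 2) (Fin 2) ℂ) = exp ((Complex.I * ((κ y : ℝ) : ℂ)) • σ₃) := by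
  rw [hW, blockMap_blockBase, if_pos rfl]

/-- The OFF-CORNER values on the block of `y`: `W(x) = exp(−iκ(y)σ₃∕(Lᵈ − 1))`. [cite: Balaban1985RegularSpaces, (1.29) p.81] -/
theorem coe_compensator_off_corner {y x : Site d} (hx : x ∈ blockSites L y) (hxc : x ≠ blockBase L y) :
    ((W x : (Matrix (Fin 2) (Fin 2) ℂ)ˣ) : Matrix (Fin 2) (Fin 2) ℂ) = exp ((Complex.I * ((-κ y / ((L : ℝ) ^ d - 1) : ℝ) : ℂ)) • σ₃) := by
  rw [hW, (mem_blockSites_iff L y x).mp hx, if_neg (Ne.symm hxc)]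

omit [NeZero L] in
/-- The compensator is `SU(2)`-valued (every value is `e^{irσ₃}`, `r` real). [cite: Balaban1985Averaging, (19) p.21] -/
theorem compensator_mem_specialUnitaryUnits (z : Site d) : W z ∈ specialUnitaryUnits (Fin 2) := by
  rw [mem_specialUnitaryUnits, hW, ← smul_smul, ← coe_expHerm (real_smul_σ₃_isHermitian_and_trace _)]
  exact (expHerm _).2

include hd hL hκ

/-- ★★ **THE LEVEL-1 AVERAGE (1.29)∕(78) OF THE COMPENSATOR AT THE TRIVIAL BACKGROUND IS `1` AT EVERY BLOCK**: prefactor = corner value `e^{iκσ₃}`, the corner term of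
the exponent is `log 1 = 0`, each of the `Lᵈ − 1` other terms is `L⁻ᵈ·log(e^{−iκσ₃}e^{−iκσ₃∕(Lᵈ−1)}) = −L⁻ᵈ·iκ(1 + 1∕(Lᵈ−1))σ₃` (principal log, `|κ| ≤ 1∕20`), total
`−iκσ₃`; `e^{iκσ₃}·e^{−iκσ₃} = 1`. [cite: Balaban1985Averaging, (78) p.30; Balaban1985RegularSpaces, (1.29) p.81] -/
theorem rbar_one_compensator (y : Site d) :
    Rbar (zdBlocking d L) (bgT L (1 : Site d → Fin d → (Matrix (Fin 2) (Fin 2) ℂ)ˣ)) 1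
      (fun x => ((W x : (Matrix (Fin 2) (Fin 2) ℂ)ˣ) : Matrix (Fin 2) (Fin 2) ℂ)) y = 1 := by
  classical
  -- letters
  set a : ℂ := Complex.I * ((κ y : ℝ) : ℂ) with ha
  set b : ℂ := Complex.I * ((-κ y / ((L : ℝ) ^ d - 1) : ℝ) : ℂ) with hb
  set c : Site d := blockBase L y with hc
  have hLd1 : (1 : ℝ) ≤ (L : ℝ) ^ d - 1 := by
    have h2 : (2 : ℝ) ≤ (L : ℝ) ^ d := by
      calc (2 : ℝ) ≤ (L : ℝ) := by exact_mod_cast hL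
        _ = (L : ℝ) ^ 1 := (pow_one _).symm
        _ ≤ (L : ℝ) ^ d := pow_le_pow_right₀ (by exact_mod_cast (by omega : 1 ≤ L)) hd
    linarith
  have hLdpos : (0 : ℝ) < (L : ℝ) ^ d := by positivity
  have hcmem : c ∈ blockSites L y := (mem_blockSites_iff L y c).mpr (blockMap_blockBase L y)
  have hcW : ((W c : (Matrix (Fin 2) (Fin 2) ℂ)ˣ) : Matrix (Fin 2) (Fin 2) ℂ) = exp (a • σ₃) := coe_compensator_corner κ hW y
  have hcWinv : Ring.inverse (((W c : (Matrix (Fin 2) (Fin 2) ℂ)ˣ) : Matrix (Fin 2) (Fin 2) ℂ)) = exp ((-a) • σ₃) := by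
    rw [Ring.inverse_unit]
    exact Units.inv_eq_of_mul_eq_one_right (by rw [hcW, exp_smul_σ₃_mul_neg])
  -- the size of the off-corner exponent
  have hsmall : ‖-a + b‖ ≤ 1 / 5 := by
    have h1 : ‖a‖ = |κ y| := by rw [ha, norm_mul, Complex.norm_I, one_mul, Complex.norm_real, Real.norm_eq_abs]
    have h2 : ‖b‖ ≤ |κ y| := by
      rw [hb, norm_mul, Complex.norm_I, one_mul, Complex.norm_real, Real.norm_eq_abs, abs_div, abs_neg,
        abs_of_pos (by linarith : (0 : ℝ) < (L : ℝ) ^ d - 1)]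
      exact div_le_self (abs_nonneg _) hLd1
    calc ‖-a + b‖ ≤ ‖-a‖ + ‖b‖ := norm_add_le _ _
      _ = ‖a‖ + ‖b‖ := by rw [norm_neg]
      _ ≤ |κ y| + |κ y| := by rw [h1]; linarith
      _ ≤ 1 / 5 := by linarith [hκ y]
  -- unfold the average (one step (78) over the block, trivial transporters)
  rw [Rbar_succ]
  show avgStep (blockSites L y) (fun _ => ((L : ℝ) ^ d)⁻¹) (bgT L (1 : Site d → Fin d → (Matrix (Fin 2) (Fin 2) ℂ)ˣ) 0 y)
      (((W c : (Matrix (Fin 2) (Fin 2) ℂ)ˣ) : Matrix (Fin 2) (Fin 2) ℂ)) (fun x => ((W x : (Matrix (Fin 2) (Fin 2) ℂ)ˣ) : Matrix (Fin 2) (Fin 2) ℂ)) = 1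
  rw [avgStep_eq_mul_exp_sum, bgT_one, hcWinv]
  have hterm : ∀ x ∈ blockSites L y,
      ((L : ℝ) ^ d)⁻¹ • mlog (exp ((-a) • σ₃) * conjR ((fun (_ : ℕ) (_ _ : Site d) => (1 : (Matrix (Fin 2) (Fin 2) ℂ)ˣ)) 0 y x)
        (((W x : (Matrix (Fin 2) (Fin 2) ℂ)ˣ) : Matrix (Fin 2) (Fin 2) ℂ)))
        = if x = c then 0 else ((((L : ℝ) ^ d)⁻¹ : ℝ) : ℂ) • ((-a + b) • σ₃) := by
    intro x hx
    beta_reduce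
    rw [one_conjR]
    by_cases hxc : x = c
    · rw [if_pos hxc, hxc, hcW, exp_neg_smul_σ₃_mul, mlog_one, smul_zero]
    · rw [if_neg hxc, coe_compensator_off_corner κ hW hx hxc, ← hb, exp_smul_σ₃_mul_exp_smul_σ₃, mlog_exp_smul_σ₃ hsmall]
      rfl
  rw [Finset.sum_congr rfl hterm, Finset.sum_ite, Finset.sum_const_zero, zero_add, Finset.sum_const]
  -- the exponent is `−a•σ₃`
  have hcard : ((blockSites L y).filter (fun x => ¬x = c)).card = L ^ d - 1 := by
    rw [Finset.filter_ne', Finset.card_erase_of_mem hcmem, card_blockSites]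
  rw [hcard]
  have hexp : (L ^ d - 1) • (((((L : ℝ) ^ d)⁻¹ : ℝ) : ℂ) • ((-a + b) • σ₃)) = (-a) • σ₃ := by
    rw [← Nat.cast_smul_eq_nsmul ℂ, smul_smul, smul_smul]
    congr 1
    have hn : ((L ^ d - 1 : ℕ) : ℂ) = (L : ℂ) ^ d - 1 := by
      rw [Nat.cast_sub (Nat.one_le_pow _ _ (by omega)), Nat.cast_pow, Nat.cast_one]
    have hne : ((L : ℂ) ^ d - 1) ≠ 0 := by
      have : ((L : ℝ) ^ d - 1 : ℝ) ≠ 0 := by linarith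
      exact_mod_cast this
    have hLne : ((L : ℂ) ^ d) ≠ 0 := by exact_mod_cast hLdpos.ne'
    rw [hn, ha, hb]
    push_cast
    field_simp
    ring
  rw [hexp, hcW, exp_smul_σ₃_mul_neg]

/-! ## §3 (1.29) for the compensator at one averaging level -/

/-- ★★ **THE COMPENSATOR MEETS THE RESTRICTION (1.29) AT ONE AVERAGING LEVEL, `Λ = torusLam 1`, TRIVIAL BACKGROUND** — although its corner values `e^{iκ(y)σ₃}` are free.
[cite: Balaban1985RegularSpaces, (1.29) p.81] -/
theorem restr129_compensator : Restr129 L 1 (torusLam 1) (1 : Site d → Fin d → (Matrix (Fin 2) (Fin 2) ℂ)ˣ) W := by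
  intro j hj y hy
  rcases Nat.lt_or_ge j 1 with h0 | h1
  · have : j = 0 := by omega
    subst this
    rw [B8Thm4TorusAt.torusLam_of_ne (by norm_num : (0 : ℕ) ≠ 1)] at hy
    exact absurd hy (Set.notMem_empty y)
  · have : j = 1 := le_antisymm hj h1
    subst this
    exact rbar_one_compensator hd hL κ hW hκ y

end Compensator

/-! ## §4 Products on the `σ₃`-line inside `SU(2)` (`expHerm` of real multiples of `σ₃`) -/

section ExpHerm

open Summit.QuantumFields.YangMills.Theorems.Prop7TPrint (expHerm coe_expHerm)
open Summit.QuantumFields.YangMills.Theorems.Prop7GaugedRowsVacuousAtFlat (real_smul_σ₃_isHermitian_and_trace)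

/-- The matrix of `(expHerm (r•σ₃))⁻¹` is `e^{−irσ₃}` (`SU(2)` inverse = adjoint; `σ₃` Hermitian, `r` real). [cite: Balaban1985Variational, (112) p.294] -/
theorem coe_expHerm_real_smul_σ₃_inv (r : ℝ) :
    (((expHerm ((r : ℂ) • σ₃))⁻¹ : Matrix.specialUnitaryGroup (Fin 2) ℂ) : Matrix (Fin 2) (Fin 2) ℂ) = exp ((Complex.I * ((-r : ℝ) : ℂ)) • σ₃) := by
  show star (((expHerm ((r : ℂ) • σ₃)) : Matrix.specialUnitaryGroup (Fin 2) ℂ) : Matrix (Fin 2) (Fin 2) ℂ) = _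
  rw [coe_expHerm (real_smul_σ₃_isHermitian_and_trace r), smul_smul, star_exp, star_smul, Matrix.star_eq_conjTranspose,
    σ₃_isHermitian_and_trace.1.eq]
  congr 2
  rw [Complex.star_def, map_mul, Complex.conj_I, Complex.conj_ofReal]
  push_cast
  ring

/-- The matrix of `expHerm (r•σ₃)` is `e^{irσ₃}`. [cite: Balaban1985Variational, (112) p.294] -/
theorem coe_expHerm_real_smul_σ₃ (r : ℝ) :
    ((expHerm ((r : ℂ) • σ₃) : Matrix.specialUnitaryGroup (Fin 2) ℂ) : Matrix (Fin 2) (Fin 2) ℂ) = exp ((Complex.I * (r : ℂ)) • σ₃) := by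
  rw [coe_expHerm (real_smul_σ₃_isHermitian_and_trace r), smul_smul]

/-- `expHerm (p•σ₃) · expHerm (q•σ₃) = expHerm ((p+q)•σ₃)` in `SU(2)`. [cite: Balaban1985Variational, (112) p.294] -/
theorem expHerm_smul_σ₃_mul (p q : ℝ) : expHerm ((p : ℂ) • σ₃) * expHerm ((q : ℂ) • σ₃) = expHerm (((p + q : ℝ) : ℂ) • σ₃) := by
  apply Subtype.ext
  show ((expHerm ((p : ℂ) • σ₃) : Matrix.specialUnitaryGroup (Fin 2) ℂ) : Matrix (Fin 2) (Fin 2) ℂ) * ((expHerm ((q : ℂ) • σ₃) : Matrix.specialUnitaryGroup (Fin 2) ℂ) :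
      Matrix (Fin 2) (Fin 2) ℂ) = _
  rw [coe_expHerm_real_smul_σ₃, coe_expHerm_real_smul_σ₃, coe_expHerm_real_smul_σ₃, exp_smul_σ₃_mul_exp_smul_σ₃]
  push_cast
  rw [mul_add]

/-- `expHerm (p•σ₃) · (expHerm (q•σ₃))⁻¹ = expHerm ((p−q)•σ₃)` in `SU(2)`. [cite: Balaban1985Variational, (112) p.294] -/
theorem expHerm_smul_σ₃_mul_inv (p q : ℝ) : expHerm ((p : ℂ) • σ₃) * (expHerm ((q : ℂ) • σ₃))⁻¹ = expHerm (((p - q : ℝ) : ℂ) • σ₃) := by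
  apply Subtype.ext
  show ((expHerm ((p : ℂ) • σ₃) : Matrix.specialUnitaryGroup (Fin 2) ℂ) : Matrix (Fin 2) (Fin 2) ℂ) *
      (((expHerm ((q : ℂ) • σ₃))⁻¹ : Matrix.specialUnitaryGroup (Fin 2) ℂ) : Matrix (Fin 2) (Fin 2) ℂ) = _
  rw [coe_expHerm_real_smul_σ₃, coe_expHerm_real_smul_σ₃_inv, coe_expHerm_real_smul_σ₃, exp_smul_σ₃_mul_exp_smul_σ₃]
  push_cast
  ring_nf

end ExpHerm

end Summit.QuantumFields.YangMills.Theorems.Prop7VacuityCompensator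

end
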